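import Summits.Ventures.CertifiedManyBodySolver.Downfold.EmeryTrilayerReading
import HarnessLib

/-!
# The trilayer's even sheets against the EQUAL-LEVEL model: the inner/outer offset `δ` as an explicit,
# one-sided, second-order inflation («INFL-trilayer-even»)

Venture CertifiedManyBodySolver, cell `pub/hubbard-downfold` (stage S1 = ROUTER; n = 3 boxes #35 Hg-1223, M314 Tl-1223,
M307 Bi-2223, M306 Tl-2223), seat hubbard-downfold-mod-4 (technique B, band level); namespace
`Summit.Ventures.CertifiedManyBodySolver.Downfold.TrilayerReading`.  Sequel of `EmeryTrilayerReading` (kept apart for the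
400-line rule).  Everything here is PROVED (exact algebra).  WHAT THIS IS NOT: a statement about any material; a
per-sheet one-band MODEL of the even sector (the even sheets are NOT single layers when `δ ≠ 0` — this file prices
exactly that).

The situation.  A per-sheet one-band treatment of a mirror trilayer (what an S2 multilayer adapter or a `t⊥/t` box row
implicitly uses) takes the EQUAL-LEVEL sheets `m ± √2|t⊥(k)|` of Literature's `TrilayerSplittingIdentities` (degenerate
case) about the even-pair centre `m = (εo + s + εi)/2`, plus the exact nonbonding sheet `εo − s`.  With an inner/outer
offset `δ = εi − (εo + s) ≠ 0` (every real n = 3 box prints one: Hg-1223 direct `εIP − εOP` at X = −0.031 / −0.066 /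
−0.090 eV at 0 / 15 / 30 GPa, router/TECHNIQUE-B-TSHEETS.tsv v1.0) the true even sheets are `m ± D/2`,
`D = √(δ² + 8t²)` (`TrilayerEvenSectorClosedForm`).  Here:

* `disc_le`: `D ≤ 2√2|t| + |δ|`; with lit's floor `D ≥ 2√2|t|` (`evenSplitting_ge`): `0 ≤ D − 2√2|t| ≤ |δ|`
  (`disc_sub_mem_Icc`), and the second-order sharpening `D − 2√2|t| ≤ δ²/(4√2|t|)` for `t ≠ 0` (`disc_sub_le_sq_div`).
* Hence each even sheet lies on the OUTER side of its equal-level partner, by at most `|δ|/2` and at most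
  `δ²/(8√2|t|)` (`levelP_sub_equalLevel_mem_Icc`, `equalLevel_sub_levelM_mem_Icc`, `levelP_sub_equalLevel_le_sq`),
  uniformly in `k` — the price of a per-sheet treatment is ONE-SIDED (it under-states the splitting) and explicit.
* `evenCentre_eq`: the even-pair centre is `εo + s + δ/2 = εi − δ/2` exactly.
* A numeric instance (`δ = t = 1`: `3 − 2√2 ≤ 1/(4√2)`).

Sources: [AndersenEtAl1995, §8 Eq. (23)]; [SakakibaraEtAl2024, Table I caption]; [LuoEtAl2023, Eq. (3)].
-/

noncomputable section

namespace Summit.Ventures.CertifiedManyBodySolver.Downfold.TrilayerReading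

open Real Literature.MathematicalPhysics.QuantumLattice Literature.MathematicalPhysics.QuantumLattice.TrilayerEven

/-- `D ≤ 2√2·|t| + |δ|` (subadditivity of the square root). [folklore] -/
theorem disc_le (δ t : ℝ) : disc δ t ≤ 2 * sqrt 2 * |t| + |δ| := by
  have h2 : sqrt 2 ^ 2 = 2 := sq_sqrt (by norm_num)
  have hc : 0 ≤ 2 * sqrt 2 * |t| := by positivity
  have hsq : δ ^ 2 + 8 * t ^ 2 ≤ (2 * sqrt 2 * |t| + |δ|) ^ 2 := by
    have e : (2 * sqrt 2 * |t| + |δ|) ^ 2 = 8 * t ^ 2 + δ ^ 2 + 2 * (2 * sqrt 2 * |t|) * |δ| := by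
      have : (2 * sqrt 2 * |t|) ^ 2 = 8 * t ^ 2 := by
        rw [mul_pow, mul_pow, h2, sq_abs]; ring
      nlinarith [this, sq_abs δ]
    rw [e]
    nlinarith [mul_nonneg hc (abs_nonneg δ)]
  rw [disc_def]
  calc sqrt (δ ^ 2 + 8 * t ^ 2) ≤ sqrt ((2 * sqrt 2 * |t| + |δ|) ^ 2) := sqrt_le_sqrt hsq
    _ = 2 * sqrt 2 * |t| + |δ| := sqrt_sq (by positivity)

/-- `0 ≤ D − 2√2·|t| ≤ |δ|`. [folklore] -/
theorem disc_sub_mem_Icc (δ t : ℝ) :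
    0 ≤ disc δ t - 2 * sqrt 2 * |t| ∧ disc δ t - 2 * sqrt 2 * |t| ≤ |δ| := by
  constructor
  · linarith [evenSplitting_ge δ t]
  · linarith [disc_le δ t]

/-- The sharper second-order bound for `t ≠ 0`: `D − 2√2·|t| ≤ δ²/(4√2·|t|)` (from
`(D − 2√2|t|)(D + 2√2|t|) = δ²` and `D + 2√2|t| ≥ 4√2|t|`). [folklore] -/
theorem disc_sub_le_sq_div {δ t : ℝ} (ht : t ≠ 0) :
    disc δ t - 2 * sqrt 2 * |t| ≤ δ ^ 2 / (4 * sqrt 2 * |t|) := by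
  have h2 : sqrt 2 ^ 2 = 2 := sq_sqrt (by norm_num)
  have hta : 0 < |t| := abs_pos.mpr ht
  have hc : 0 < 2 * sqrt 2 * |t| := by positivity
  have hge := evenSplitting_ge δ t
  have hD2 := disc_sq δ t
  have hc2 : (2 * sqrt 2 * |t|) ^ 2 = 8 * t ^ 2 := by rw [mul_pow, mul_pow, h2, sq_abs]; ring
  have hprod : (disc δ t - 2 * sqrt 2 * |t|) * (disc δ t + 2 * sqrt 2 * |t|) = δ ^ 2 := by
    nlinarith [hD2, hc2]
  have hpos : 0 < disc δ t + 2 * sqrt 2 * |t| := by linarith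
  have heq : disc δ t - 2 * sqrt 2 * |t| = δ ^ 2 / (disc δ t + 2 * sqrt 2 * |t|) := by
    rw [eq_div_iff hpos.ne']; exact hprod
  rw [heq, show 4 * sqrt 2 * |t| = 2 * (2 * sqrt 2 * |t|) by ring]
  exact div_le_div_of_nonneg_left (sq_nonneg δ) (by positivity) (by linarith)

/-- **Upper even sheet vs the equal-level model**: `0 ≤ λ_+ − (m + √2|t|) ≤ |δ|/2`, `m = (εo + s + εi)/2`.
[folklore] -/
theorem levelP_sub_equalLevel_mem_Icc (εo εi t s : ℝ) :
    0 ≤ levelP εo εi t s - ((εo + s + εi) / 2 + sqrt 2 * |t|) ∧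
      levelP εo εi t s - ((εo + s + εi) / 2 + sqrt 2 * |t|) ≤ |offset εo εi s| / 2 := by
  obtain ⟨h0, h1⟩ := disc_sub_mem_Icc (offset εo εi s) t
  rw [levelP_def]
  constructor <;> linarith

/-- **Lower even sheet vs the equal-level model**: `0 ≤ (m − √2|t|) − λ_− ≤ |δ|/2`. [folklore] -/
theorem equalLevel_sub_levelM_mem_Icc (εo εi t s : ℝ) :
    0 ≤ ((εo + s + εi) / 2 - sqrt 2 * |t|) - levelM εo εi t s ∧
      ((εo + s + εi) / 2 - sqrt 2 * |t|) - levelM εo εi t s ≤ |offset εo εi s| / 2 := by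
  obtain ⟨h0, h1⟩ := disc_sub_mem_Icc (offset εo εi s) t
  rw [levelM_def]
  constructor <;> linarith

/-- Second-order version for `t ≠ 0`: each even sheet deviates from its equal-level partner by at most
`δ²/(8√2·|t|)`. [folklore] -/
theorem levelP_sub_equalLevel_le_sq {εo εi t s : ℝ} (ht : t ≠ 0) :
    levelP εo εi t s - ((εo + s + εi) / 2 + sqrt 2 * |t|) ≤ offset εo εi s ^ 2 / (8 * sqrt 2 * |t|) ∧
      ((εo + s + εi) / 2 - sqrt 2 * |t|) - levelM εo εi t s ≤ offset εo εi s ^ 2 / (8 * sqrt 2 * |t|) := by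
  have h := disc_sub_le_sq_div (δ := offset εo εi s) ht
  have hpos : 0 < 8 * sqrt 2 * |t| := by have := abs_pos.mpr ht; positivity
  have e : offset εo εi s ^ 2 / (8 * sqrt 2 * |t|) = (offset εo εi s ^ 2 / (4 * sqrt 2 * |t|)) / 2 := by
    field_simp
    ring
  rw [levelP_def, levelM_def, e]
  constructor <;> linarith

/-- The even-pair CENTRE sits `δ/2` above the outer-even level and `δ/2` below the inner level, exactly:
`(λ_+ + λ_−)/2 = εo + s + δ/2 = εi − δ/2`. [folklore] -/
theorem evenCentre_eq (εo εi t s : ℝ) :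
    (levelP εo εi t s + levelM εo εi t s) / 2 = εo + s + offset εo εi s / 2 ∧
      (levelP εo εi t s + levelM εo εi t s) / 2 = εi - offset εo εi s / 2 := by
  have h := levelP_add_levelM εo εi t s
  rw [offset_def]
  constructor <;> linarith

/-- The splitting itself is bracketed: `2√2|t| ≤ λ_+ − λ_− ≤ 2√2|t| + |δ|`. [folklore] -/
theorem evenSplitting_mem_Icc (εo εi t s : ℝ) :
    2 * sqrt 2 * |t| ≤ levelP εo εi t s - levelM εo εi t s ∧
      levelP εo εi t s - levelM εo εi t s ≤ 2 * sqrt 2 * |t| + |offset εo εi s| := by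
  rw [evenSplitting]
  exact ⟨evenSplitting_ge _ _, disc_le _ _⟩

/-- Instance (`δ = t = 1`: `D = 3`): the second-order bound reads `3 − 2√2 ≤ 1/(4√2)` (numerically
`0.1716 ≤ 0.1768`). [folklore] -/
theorem instance_secondOrder : 3 - 2 * sqrt 2 * |(1:ℝ)| ≤ (1:ℝ) ^ 2 / (4 * sqrt 2 * |(1:ℝ)|) := by
  have h := disc_sub_le_sq_div (δ := 1) (t := 1) one_ne_zero
  have hD : disc 1 1 = 3 := by
    rw [disc_def, show ((1:ℝ)) ^ 2 + 8 * 1 ^ 2 = 3 ^ 2 by norm_num]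
    exact sqrt_sq (by norm_num)
  rwa [hD] at h

end Summit.Ventures.CertifiedManyBodySolver.Downfold.TrilayerReading

end
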